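import Summits.Langlands.Langlands.Theses.SymmetricPowerAnchorSplit

/-!
# Route SymmetricPowerAnchorSplit — Assembly

The assembly item (stmt-Langlands-28349) of the child route `SymmetricPowerAnchorSplit` (decomp-langlands lens-3 gen 14,
rev 1; refines `MonodromyDichotomy.SymmetricPowerTransport`, stmt-Langlands-31221) for the Langlands summit:
`AnchorlessSymTypeAutomorphy → CMSymmetricPowerAutomorphy → LowSymmetricPowerAutomorphy → HilbertSymmetricPowerAutomorphy →
CliffordSolvableDescent → SolvableAnchorTransport → AvatarSymmetricPowerFrame → Langlands`.

This is literally the type of the route file's sorry-free deciding theorem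
`Summit.Langlands.Langlands.Theses.SymmetricPowerAnchorSplit.closes` (rev-1 glue: FRAME′ hands down the host binder W⁺;
excluded middle on the low / cohomological anchor dials; LS / FT / FC at the anchor field transported by T′ fed with W⁺ and
CSD; RES otherwise).  Nothing here proves `Langlands`: the assembly records only that the seven ledger items of the route,
taken together, imply the summit statement.
-/

set_option linter.dupNamespace false -- project-wide option (lakefile weak.linter.dupNamespace); `Summit.Langlands.Langlands` is the mandated namespace

namespace Summit.Langlands.Langlands.Theorems

/-- **Assembly of route SymmetricPowerAnchorSplit** (stmt-Langlands-28349):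
`RES → FC → LS → FT → CSD → T′ → FRAME′ → Langlands`.  Proof: unfold `Assembly` and apply the route's deciding theorem
`Theses.SymmetricPowerAnchorSplit.closes`. -/
theorem symmetricPowerAnchorSplit_assembly_proof :
    Summit.Langlands.Langlands.Theses.SymmetricPowerAnchorSplit.Assembly := by
  unfold Summit.Langlands.Langlands.Theses.SymmetricPowerAnchorSplit.Assembly
  exact Summit.Langlands.Langlands.Theses.SymmetricPowerAnchorSplit.closes

end Summit.Langlands.Langlands.Theorems
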